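import Summits.QuantumFields.YangMills.Theorems.FemtoTransferGapPositivityGram

/-!
# The Wilson transfer kernel of `SU(n)` is positive semi-definite: `0 ≤ ⟨ψ, K_β ψ⟩`, hence `0 ≤ λ_k(β, L)` for `β ≥ 0`
# (support module of the `FemtoTransferGap` group; discharges the registered stub `stub_transferValuesNonneg` of route `LuscherReduction`)

Fifth module of the `FemtoTransferGap` group (cell `ym-beyond`, seat P1 «RG into the infrared», memo `run/shared/lean/pub/ym-beyond/ROUTE-P1.md`
§32).  The min–max transfer values `levelValue ρ L β k` of `Theorems.FemtoTransferGapLevels` are `sInf`'s of `sSup`'s of Rayleigh quotients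
`⟨ψ,K_βψ⟩/⟨ψ,ψ⟩`; the companion module `FemtoTransferGapBounds` shows they are `≤ λ₀ < ∞` and `0 < λ₀`.  Here we prove the complementary
lower bound **`0 ≤ λ_k`** for the fundamental representation of `SU(n)` and every `β ≥ 0`, by proving that the transfer QUADRATIC FORM is
non-negative on every physical test function — positive semi-definiteness of the temporal-gauge transfer kernel, the elementary core of
Osterwalder–Seiler reflection positivity for the Wilson action [cite: OsterwalderSeiler1978, §2] [cite: SeilerLNP1982, §3]:

* §1 (abstract, any finite measure space `(X, μ)`): a FINITE GRAM KERNEL `∑ᵢ cᵢ gᵢ(x) gᵢ(y)` with `cᵢ ≥ 0` is positive semi-definite in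
  integral form, `0 ≤ ∫ Φ(x) (∑ᵢ cᵢ gᵢ(x)gᵢ(y)) Φ(y) d(μ⊗μ)` (`integral_prod_gram_nonneg`: it equals `∑ᵢ cᵢ (∫Φgᵢ)²`, Fubini for products);
  powers of a Gram kernel are Gram kernels (`gram_pow_eq_sum`, multinomial expansion over `Fin n → ι`), so every TRUNCATED EXPONENTIAL
  `∑_{n<m} (βT)ⁿ/n!` of a bounded measurable Gram kernel `T` with `β ≥ 0` is positive semi-definite (`integral_prod_expTrunc_gram_nonneg`), and by
  dominated convergence (`|∑_{n<m} yⁿ/n!| ≤ e^{|y|}`, `Real.sum_le_exp_of_nonneg`) so is `exp(βT)` (`integral_prod_exp_gram_nonneg`);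
* §2 (the Wilson kernel): for the fundamental representation of `SU(n)` the time-like coupling is a Gram kernel,
  `∑ₑ Re tr(Uₑ Vₑ⁻¹) = ∑ₑ Re tr(Uₑ Vₑᴴ) = ∑_{e,i,j} (Re Uₑᵢⱼ Re Vₑᵢⱼ + Im Uₑᵢⱼ Im Vₑᵢⱼ)` (`timeCoupling_fundamentalRep_eq_gram`, features
  `suFeature`), and `ψ(U)K_β(U,V)ψ(V) = Φ(U) e^{β T(U,V)} Φ(V)` with `Φ = ψ·e^{−(β/2)S}`; hence **`0 ≤ qform (fundamentalRep (Fin n)) β ψ ψ`** for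
  every physical `ψ` and `β ≥ 0` (`qform_self_nonneg_fundamentalRep`);
* §3 `0 ≤ levelValue` whenever the quadratic form is non-negative (`levelValue_nonneg_of_qform_nonneg`, real `sInf`/`sSup` conventions included),
  so `0 ≤ λ_k(β, L)` for `SU(n)`, `β ≥ 0`, every `k`, `L` (`levelValue_fundamentalRep_nonneg`, `levelValue_su2Rep_nonneg`), and
  **`transferValuesNonneg : ∀ L β k, 1 ≤ β → 0 ≤ levelValue su2Rep L β k`** — VERBATIM the statement `TransferValuesNonneg` of the registered BC3
  birth skeleton of crux `RunningReduction` (stub `stub_transferValuesNonneg` = S3, item stmt-QuantumFields-19978) of route `LuscherReduction`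
  (QuantumFields / YangMills; rung leaf R2b1 `FemtoGapOfRecord`), dischargeable by name.  With `FemtoTransferGapBounds`: `0 ≤ λ_k ≤ λ₀`, `0 < λ₀`.

## WHAT THIS IS NOT
Not reflection positivity of the full lattice theory with its OS reconstruction (only the positivity of the temporal-gauge transfer kernel as a
quadratic form on bounded measurable functions), not a gap, NOT THE CLAY GAP.  Everything below is proved (no `sorry`, no new axiom, no named
fact).

## FILING NOTE (courier seat `ym-beyond-courier`; no mathematics added, no statement changed)
Part 2/2 of the faithful two-module partition of seat P1 g10's payload `p1-g10-files/FemtoTransferGapPositivity.lean` (sha16 0895ebc796f7c5a3):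
§2–§3 here; §1 (abstract Gram-kernel positivity) is `Theorems/FemtoTransferGapPositivityGram.lean`, imported.  Split forced by the 400-line cap on
Theorems files with proofs.  The module docstring above is the payload's, verbatim.
-/

set_option autoImplicit false

noncomputable section

open MeasureTheory Filter Topology Real
open scoped Nat
open Literature.MathematicalPhysics.QuantumFieldTheory
open Literature.MathematicalPhysics.QuantumLattice
open Literature.Analysis.OperatorTheory.YMMatrixModel

namespace Summit.QuantumFields.YangMills.Theorems.FemtoTransferGap

/-! ### §2. The Wilson time-like coupling of `SU(n)` is a Gram kernel; the transfer quadratic form is non-negative -/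

section Fundamental

variable {n : ℕ}

/-- The real features of a spatial configuration of `SU(n)` matrices: real and imaginary parts of all matrix entries of all links,
indexed by `(edge, (row, column), re?/im?)`. [folklore] -/
def suFeature (n L : ℕ) (a : Edge 3 L × (Fin n × Fin n) × Bool)
    (U : GaugeConfig 3 L (Matrix.specialUnitaryGroup (Fin n) ℂ)) : ℝ :=
  match a.2.2 with
  | true => ((U a.1 : Matrix (Fin n) (Fin n) ℂ) a.2.1.1 a.2.1.2).re
  | false => ((U a.1 : Matrix (Fin n) (Fin n) ℂ) a.2.1.1 a.2.1.2).im

/-- The features are continuous. [folklore] -/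
theorem continuous_suFeature (L : ℕ) (a : Edge 3 L × (Fin n × Fin n) × Bool) : Continuous (suFeature n L a) := by
  obtain ⟨e, ⟨i, j⟩, b⟩ := a
  have h : Continuous fun U : GaugeConfig 3 L (Matrix.specialUnitaryGroup (Fin n) ℂ) =>
      (U e : Matrix (Fin n) (Fin n) ℂ) i j :=
    (continuous_subtype_val.comp (continuous_apply e)).matrix_elem i j
  cases b
  · exact (Complex.continuous_im.comp h).congr fun U => by simp [suFeature]
  · exact (Complex.continuous_re.comp h).congr fun U => by simp [suFeature]

/-- The features are bounded by `1` (entries of a unitary matrix have norm `≤ 1`). [folklore] -/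
theorem abs_suFeature_le_one (L : ℕ) (a : Edge 3 L × (Fin n × Fin n) × Bool)
    (U : GaugeConfig 3 L (Matrix.specialUnitaryGroup (Fin n) ℂ)) : |suFeature n L a U| ≤ 1 := by
  obtain ⟨e, ⟨i, j⟩, b⟩ := a
  have h : ‖(U e : Matrix (Fin n) (Fin n) ℂ) i j‖ ≤ 1 :=
    entry_norm_bound_of_unitary (Matrix.specialUnitaryGroup_le_unitaryGroup (U e).2) i j
  cases b
  · have h' : suFeature n L (e, (i, j), false) U = ((U e : Matrix (Fin n) (Fin n) ℂ) i j).im := by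
      simp [suFeature]
    rw [h']
    exact (Complex.abs_im_le_norm _).trans h
  · have h' : suFeature n L (e, (i, j), true) U = ((U e : Matrix (Fin n) (Fin n) ℂ) i j).re := by
      simp [suFeature]
    rw [h']
    exact (Complex.abs_re_le_norm _).trans h

/-- `Re tr(A B⁻¹) = Re tr(A Bᴴ) = ∑_{i,j} (Re Aᵢⱼ Re Bᵢⱼ + Im Aᵢⱼ Im Bᵢⱼ)` for `A, B ∈ SU(n)` in the fundamental representation. [folklore] -/
theorem re_trace_fundamentalRep_mul_inv (A B : Matrix.specialUnitaryGroup (Fin n) ℂ) :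
    ((fundamentalRep (Fin n) (A * B⁻¹)).trace).re
      = ∑ i, ∑ j, (((A : Matrix (Fin n) (Fin n) ℂ) i j).re * ((B : Matrix (Fin n) (Fin n) ℂ) i j).re
          + ((A : Matrix (Fin n) (Fin n) ℂ) i j).im * ((B : Matrix (Fin n) (Fin n) ℂ) i j).im) := by
  rw [← Matrix.star_eq_inv, fundamentalRep_apply, Submonoid.coe_mul, Matrix.specialUnitaryGroup.coe_star,
    Matrix.star_eq_conjTranspose]
  simp only [Matrix.trace, Matrix.diag_apply, Matrix.mul_apply, Matrix.conjTranspose_apply, Complex.re_sum,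
    Complex.mul_re, RCLike.star_def, Complex.conj_re, Complex.conj_im]
  refine Finset.sum_congr rfl fun i _ => Finset.sum_congr rfl fun j _ => ?_
  ring

/-- **The time-like coupling of the fundamental representation is a Gram kernel**:
`∑ₑ Re tr(Uₑ Vₑ⁻¹) = ∑ₑ Re tr(Uₑ Vₑᴴ) = ∑_{e,i,j} (Re Uₑᵢⱼ · Re Vₑᵢⱼ + Im Uₑᵢⱼ · Im Vₑᵢⱼ)`. [folklore] -/
theorem timeCoupling_fundamentalRep_eq_gram {L : ℕ} [NeZero L]
    (U V : GaugeConfig 3 L (Matrix.specialUnitaryGroup (Fin n) ℂ)) :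
    timeCoupling (fundamentalRep (Fin n)) U V = ∑ a, suFeature n L a U * suFeature n L a V := by
  unfold timeCoupling
  simp only [re_trace_fundamentalRep_mul_inv, Fintype.sum_prod_type, Fintype.sum_bool, suFeature]

/-- **The transfer quadratic form of `SU(n)` is non-negative**: `0 ≤ ⟨ψ, K_β ψ⟩` for every physical test function `ψ` and every `β ≥ 0`
(`ψ(U)K_β(U,V)ψ(V) = Φ(U) e^{βT(U,V)} Φ(V)` with `Φ = ψ e^{−(β/2)S}` and `T` the Gram kernel of §2; Fubini + §1). [cite: OsterwalderSeiler1978, §2] -/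
theorem qform_self_nonneg_fundamentalRep {L : ℕ} [NeZero L] {β : ℝ} (hβ : 0 ≤ β)
    {ψ : GaugeConfig 3 L (Matrix.specialUnitaryGroup (Fin n) ℂ) → ℝ} (hψ : IsPhys ψ) :
    0 ≤ qform (fundamentalRep (Fin n)) β ψ ψ := by
  haveI : SecondCountableTopology (Matrix (Fin n) (Fin n) ℂ) :=
    inferInstanceAs (SecondCountableTopology (Fin n → Fin n → ℂ))
  haveI : SecondCountableTopology (Matrix.specialUnitaryGroup (Fin n) ℂ) :=
    TopologicalSpace.Subtype.secondCountableTopology _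
  obtain ⟨C, hC⟩ := hψ.bounded
  have hC0 : 0 ≤ C := (abs_nonneg _).trans (hC fun _ => 1)
  -- the weight `w = e^{−(β/2) S}` and `Φ = ψ w`
  have hw_cont : Continuous fun U : GaugeConfig 3 L (Matrix.specialUnitaryGroup (Fin n) ℂ) =>
      Real.exp (-(β / 2) * wilsonAction (fundamentalRep (Fin n)) U) :=
    Real.continuous_exp.comp (continuous_const.mul
      (continuous_wilsonAction (fundamentalRep (Fin n)) (continuous_fundamentalRep (Fin n))))
  obtain ⟨W, hW⟩ := (isCompact_range hw_cont).bddAbove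
  have hWle : ∀ U, Real.exp (-(β / 2) * wilsonAction (fundamentalRep (Fin n)) U) ≤ W :=
    fun U => hW (Set.mem_range_self U)
  set Φ : GaugeConfig 3 L (Matrix.specialUnitaryGroup (Fin n) ℂ) → ℝ :=
    fun U => ψ U * Real.exp (-(β / 2) * wilsonAction (fundamentalRep (Fin n)) U) with hΦdef
  have hΦm : Measurable Φ := hψ.measurable.mul hw_cont.measurable
  have hΦb : ∀ U, |Φ U| ≤ C * W := by
    intro U
    rw [hΦdef, abs_mul, abs_of_pos (Real.exp_pos _)]
    exact mul_le_mul (hC U) (hWle U) (Real.exp_pos _).le hC0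
  have hCW : 0 ≤ C * W := (abs_nonneg _).trans (hΦb fun _ => 1)
  -- features
  have hgm : ∀ a, Measurable (suFeature n L a) := fun a => (continuous_suFeature L a).measurable
  have hgb : ∀ a U, |suFeature n L a U| ≤ 1 := abs_suFeature_le_one L
  have hTm : Measurable fun p : GaugeConfig 3 L (Matrix.specialUnitaryGroup (Fin n) ℂ) ×
      GaugeConfig 3 L (Matrix.specialUnitaryGroup (Fin n) ℂ) => ∑ a, suFeature n L a p.1 * suFeature n L a p.2 :=
    measurable_gram _ hgm
  have hTb := fun p : GaugeConfig 3 L (Matrix.specialUnitaryGroup (Fin n) ℂ) ×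
      GaugeConfig 3 L (Matrix.specialUnitaryGroup (Fin n) ℂ) => abs_gram_le (suFeature n L) zero_le_one hgb p.1 p.2
  -- the integrand identity
  have hK : ∀ U V, ψ U * transferKernel (fundamentalRep (Fin n)) β U V * ψ V
      = Φ U * Real.exp (β * ∑ a, suFeature n L a U * suFeature n L a V) * Φ V := by
    intro U V
    rw [← timeCoupling_fundamentalRep_eq_gram, hΦdef]
    simp only [transferKernel]
    rw [show β * timeCoupling (fundamentalRep (Fin n)) U V
          - β / 2 * (wilsonAction (fundamentalRep (Fin n)) U + wilsonAction (fundamentalRep (Fin n)) V)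
        = β * timeCoupling (fundamentalRep (Fin n)) U V + -(β / 2) * wilsonAction (fundamentalRep (Fin n)) U
          + -(β / 2) * wilsonAction (fundamentalRep (Fin n)) V by ring, Real.exp_add, Real.exp_add]
    ring
  have hint : Integrable (fun p : GaugeConfig 3 L (Matrix.specialUnitaryGroup (Fin n) ℂ) ×
      GaugeConfig 3 L (Matrix.specialUnitaryGroup (Fin n) ℂ) =>
        Φ p.1 * Real.exp (β * ∑ a, suFeature n L a p.1 * suFeature n L a p.2) * Φ p.2)
      ((configMeasure _ L).prod (configMeasure _ L)) := by
    refine integrable_sandwich (configMeasure _ L)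
      (H := fun p => Real.exp (β * ∑ a, suFeature n L a p.1 * suFeature n L a p.2)) (hTm.const_mul β).exp
      (R := Real.exp (β * (Fintype.card (Edge 3 L × (Fin n × Fin n) × Bool) * 1 ^ 2))) (fun p => ?_) hΦm hΦb
    show |Real.exp (β * ∑ a, suFeature n L a p.1 * suFeature n L a p.2)| ≤ _
    rw [abs_of_pos (Real.exp_pos _)]
    refine Real.exp_le_exp.mpr ?_
    exact (le_abs_self _).trans (by rw [abs_mul, abs_of_nonneg hβ]; exact mul_le_mul_of_nonneg_left (hTb p) hβ)
  have hq : qform (fundamentalRep (Fin n)) β ψ ψ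
      = ∫ p, Φ p.1 * Real.exp (β * ∑ a, suFeature n L a p.1 * suFeature n L a p.2) * Φ p.2
          ∂(configMeasure _ L).prod (configMeasure _ L) := by
    unfold qform
    simp_rw [hK]
    exact (integral_prod _ hint).symm
  rw [hq]
  exact integral_prod_exp_gram_nonneg (configMeasure (Matrix.specialUnitaryGroup (Fin n) ℂ) L) (suFeature n L) hgm
    zero_le_one hgb Φ hΦm hCW hΦb hβ

/-- Every Rayleigh quotient of the `SU(n)` transfer kernel is non-negative for `β ≥ 0`. [folklore] -/
theorem rayleigh_nonneg_fundamentalRep {L : ℕ} [NeZero L] {β : ℝ} (hβ : 0 ≤ β)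
    {P : (GaugeConfig 3 L (Matrix.specialUnitaryGroup (Fin n) ℂ) → ℝ) → Prop} {r : ℝ}
    (hr : r ∈ rayleighSet (fundamentalRep (Fin n)) L β P) : 0 ≤ r := by
  obtain ⟨ψ, hψ, -, hpos, rfl⟩ := hr
  exact div_nonneg (qform_self_nonneg_fundamentalRep hβ hψ) hpos.le

end Fundamental

/-! ### §3. `0 ≤ λ_k` -/

section LevelsNonneg

variable {N : ℕ} {G : Type*} [Group G] [TopologicalSpace G] [IsTopologicalGroup G] [CompactSpace G]
  [MeasurableSpace G] [BorelSpace G]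
variable (ρ : G →* Matrix (Fin N) (Fin N) ℂ)

/-- If the transfer quadratic form is non-negative on physical test functions, every min–max transfer value is `≥ 0` (with the real
conventions `sSup ∅ = 0`, `sInf` of an unbounded-below set `= 0` the conclusion holds in all degenerate cases too). [cite: ReedSimonIV1978, Thm. XIII.1] -/
theorem levelValue_nonneg_of_qform_nonneg {L : ℕ} [NeZero L] (β : ℝ)
    (h : ∀ ψ : GaugeConfig 3 L G → ℝ, IsPhys ψ → 0 ≤ qform ρ β ψ ψ) (k : ℕ) :
    0 ≤ levelValue ρ L β k := by
  unfold levelValue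
  refine Real.sInf_nonneg fun s hs => ?_
  obtain ⟨φs, -, rfl⟩ := hs
  refine Real.sSup_nonneg fun r hr => ?_
  obtain ⟨ψ, hψ, -, hpos, rfl⟩ := hr
  exact div_nonneg (h ψ hψ) hpos.le

end LevelsNonneg

/-- **`0 ≤ λ_k(β, L)` for `SU(n)`**, every `k`, every `L ≥ 1`, every `β ≥ 0`. [cite: OsterwalderSeiler1978, §2] -/
theorem levelValue_fundamentalRep_nonneg {n : ℕ} (L : ℕ) [NeZero L] {β : ℝ} (hβ : 0 ≤ β) (k : ℕ) :
    0 ≤ levelValue (fundamentalRep (Fin n)) L β k :=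
  levelValue_nonneg_of_qform_nonneg (fundamentalRep (Fin n)) β
    (fun _ hψ => qform_self_nonneg_fundamentalRep hβ hψ) k

/-- `0 ≤ λ_k(β, L)` for the `SU(2)` leaves, `β ≥ 0`. [folklore] -/
theorem levelValue_su2Rep_nonneg (L : ℕ) [NeZero L] {β : ℝ} (hβ : 0 ≤ β) (k : ℕ) :
    0 ≤ levelValue su2Rep L β k :=
  levelValue_fundamentalRep_nonneg L hβ k

/-- `0 ≤ λ₁(β, L)` for the `SU(2)` leaves, `β ≥ 0`. [folklore] -/
theorem secondValue_su2Rep_nonneg (L : ℕ) [NeZero L] {β : ℝ} (hβ : 0 ≤ β) :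
    0 ≤ secondValue su2Rep L β := by
  rw [← levelValue_one]
  exact levelValue_su2Rep_nonneg L hβ 1

/-- `0 ≤ ⟨ψ, K_β ψ⟩` for the `SU(2)` leaves, `β ≥ 0`. [folklore] -/
theorem qform_su2Rep_self_nonneg {L : ℕ} [NeZero L] {β : ℝ} (hβ : 0 ≤ β) {ψ : GaugeConfig 3 L SU2 → ℝ}
    (hψ : IsPhys ψ) : 0 ≤ qform su2Rep β ψ ψ :=
  qform_self_nonneg_fundamentalRep hβ hψ

/-- **Registered stub `stub_transferValuesNonneg` DISCHARGED.**  VERBATIM the statement `TransferValuesNonneg` (S3) of the BC3 birth skeleton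
of crux `RunningReduction` (item stmt-QuantumFields-19978) of route `LuscherReduction` (QuantumFields / YangMills; rung leaf R2b1
`FemtoGapOfRecord`): the min–max transfer values of the `SU(2)` Wilson theory are non-negative at every bare coupling `β ≥ 1` (in fact `β ≥ 0`,
`levelValue_su2Rep_nonneg`). [cite: OsterwalderSeiler1978, §2] -/
theorem transferValuesNonneg :
    ∀ (L : ℕ) [NeZero L] (β : ℝ) (k : ℕ), 1 ≤ β → 0 ≤ levelValue su2Rep L β k :=
  fun L _ _ k hβ => levelValue_su2Rep_nonneg L (zero_le_one.trans hβ) k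

end Summit.QuantumFields.YangMills.Theorems.FemtoTransferGap

end
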